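import Literature.Analysis.Calculus.TangentialForms
import HarnessLib

/-!
# Differentiating tangential 3-tensors through the tangential projection

Analysis support file (everything proved; no definitions, no named facts), continuing
`TangentialForms` (A. Waldron, Invent. math. 217 (2019), §4, done extrinsically): the second
sphere-covariant derivatives of Waldron's tangential curvature `Ω = F(P·, P·)` are first
derivatives of the tangential 3-tensor field `(u, a, c) ↦ (∇^θ_{P u}Ω)(P a, P c)`, i.e. of an
ambient trilinear-map-valued field precomposed with `P` in all three slots. The Leibniz rule:

* `fderiv_trilinear_tangentialProj_apply` — for `G : E → (E →L E →L E →L F)` differentiable at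
  `x ≠ 0` and frozen arguments,
  `D(y ↦ G_y(P_y u, P_y a, P_y c))(x)v = (DG(x)v)(Pu, Pa, Pc) + G((∂_vP)u, Pa, Pc) + G(Pu, (∂_vP)a, Pc) + G(Pu, Pa, (∂_vP)c)`;
* `fderiv_trilinear_tangentialProj_apply_of_tangential` — for tangential frozen `u, a, c ⊥ x`
  each correction is a radial insertion: `−(⟨P v, u⟩/‖x‖²) G(x, a, c) − (⟨P v, a⟩/‖x‖²) G(u, x, c) − (⟨P v, c⟩/‖x‖²) G(u, a, x)`.

References: A. Waldron, Invent. math. 217 (2019), §4.2 [Waldron2019]; [folklore].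
-/

noncomputable section

open scoped RealInnerProductSpace Topology

namespace Literature.Analysis.Calculus

variable {E : Type*} [NormedAddCommGroup E] [InnerProductSpace ℝ E]
variable {F : Type*} [NormedAddCommGroup F] [NormedSpace ℝ F]

/-- **Leibniz rule for a tangential 3-tensor**: for `G : E → (E →L E →L E →L F)` differentiable at
`x ≠ 0` and frozen arguments `u, a, c`,
`D(y ↦ G_y(P_y u, P_y a, P_y c))(x)v = (DG(x)v)(Pu,Pa,Pc) + G((∂_vP)u,Pa,Pc) + G(Pu,(∂_vP)a,Pc) + G(Pu,Pa,(∂_vP)c)`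
with `(∂_vP)w = −(⟨x,w⟩P v + ⟨P v, w⟩x)/‖x‖²`. [folklore] -/
theorem fderiv_trilinear_tangentialProj_apply {G : E → E →L[ℝ] E →L[ℝ] E →L[ℝ] F} {x : E}
    (hG : DifferentiableAt ℝ G x) (hx : x ≠ 0) (u a c v : E) :
    fderiv ℝ (fun y => G y (tangentialProj y u) (tangentialProj y a) (tangentialProj y c)) x v =
      fderiv ℝ G x v (tangentialProj x u) (tangentialProj x a) (tangentialProj x c) +
        G x (-(‖x‖ ^ 2)⁻¹ • (⟪x, u⟫ • tangentialProj x v + ⟪tangentialProj x v, u⟫ • x))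
          (tangentialProj x a) (tangentialProj x c) +
        G x (tangentialProj x u)
          (-(‖x‖ ^ 2)⁻¹ • (⟪x, a⟫ • tangentialProj x v + ⟪tangentialProj x v, a⟫ • x))
          (tangentialProj x c) +
        G x (tangentialProj x u) (tangentialProj x a)
          (-(‖x‖ ^ 2)⁻¹ • (⟪x, c⟫ • tangentialProj x v + ⟪tangentialProj x v, c⟫ • x)) := by
  have hPu := (hasFDerivAt_tangentialProj_apply hx u).differentiableAt
  have hPa := (hasFDerivAt_tangentialProj_apply hx a).differentiableAt
  have hPc := (hasFDerivAt_tangentialProj_apply hx c).differentiableAt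
  -- the inner evaluations, as `CLM`-valued functions
  have h1 : DifferentiableAt ℝ (fun y => G y (tangentialProj y u)) x :=
    DifferentiableAt.clm_apply (𝕜 := ℝ) (G := E) (H := E →L[ℝ] E →L[ℝ] F) (c := G)
      (u := fun y => tangentialProj y u) hG hPu
  have h1' : fderiv ℝ (fun y => G y (tangentialProj y u)) x v =
      fderiv ℝ G x v (tangentialProj x u) +
        G x (-(‖x‖ ^ 2)⁻¹ • (⟪x, u⟫ • tangentialProj x v + ⟪tangentialProj x v, u⟫ • x)) := by
    rw [fderiv_clm_apply (𝕜 := ℝ) (G := E) (H := E →L[ℝ] E →L[ℝ] F) (c := G)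
      (u := fun y => tangentialProj y u) hG hPu]
    simp only [FunLike.coe_add, Pi.add_apply, ContinuousLinearMap.comp_apply,
      ContinuousLinearMap.flip_apply]
    rw [fderiv_tangentialProj_apply hx u v, add_comm]
  have h2 : DifferentiableAt ℝ (fun y => G y (tangentialProj y u) (tangentialProj y a)) x :=
    DifferentiableAt.clm_apply (𝕜 := ℝ) (G := E) (H := E →L[ℝ] F)
      (c := fun y => G y (tangentialProj y u)) (u := fun y => tangentialProj y a) h1 hPa
  have h2' : fderiv ℝ (fun y => G y (tangentialProj y u) (tangentialProj y a)) x v =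
      fderiv ℝ G x v (tangentialProj x u) (tangentialProj x a) +
        G x (-(‖x‖ ^ 2)⁻¹ • (⟪x, u⟫ • tangentialProj x v + ⟪tangentialProj x v, u⟫ • x))
          (tangentialProj x a) +
        G x (tangentialProj x u)
          (-(‖x‖ ^ 2)⁻¹ • (⟪x, a⟫ • tangentialProj x v + ⟪tangentialProj x v, a⟫ • x)) := by
    rw [fderiv_clm_apply (𝕜 := ℝ) (G := E) (H := E →L[ℝ] F)
      (c := fun y => G y (tangentialProj y u)) (u := fun y => tangentialProj y a) h1 hPa]
    simp only [FunLike.coe_add, Pi.add_apply, ContinuousLinearMap.comp_apply,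
      ContinuousLinearMap.flip_apply]
    rw [h1', fderiv_tangentialProj_apply hx a v, FunLike.coe_add, Pi.add_apply]
    abel
  rw [fderiv_clm_apply h2 hPc]
  simp only [FunLike.coe_add, Pi.add_apply, ContinuousLinearMap.comp_apply,
    ContinuousLinearMap.flip_apply]
  rw [h2', fderiv_tangentialProj_apply hx c v, FunLike.coe_add, Pi.add_apply, FunLike.coe_add,
    Pi.add_apply]
  abel

/-- The same for tangential frozen arguments `u, a, c ⊥ x`: each correction is a radial insertion,
`D(y ↦ G_y(P_y u, P_y a, P_y c))(x)v = (DG(x)v)(u, a, c) − (⟨Pv,u⟩/‖x‖²) G(x,a,c) − (⟨Pv,a⟩/‖x‖²) G(u,x,c) − (⟨Pv,c⟩/‖x‖²) G(u,a,x)`.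
[folklore] -/
theorem fderiv_trilinear_tangentialProj_apply_of_tangential {G : E → E →L[ℝ] E →L[ℝ] E →L[ℝ] F}
    {x : E} (hG : DifferentiableAt ℝ G x) (hx : x ≠ 0) {u a c : E} (hu : ⟪x, u⟫ = 0)
    (ha : ⟪x, a⟫ = 0) (hc : ⟪x, c⟫ = 0) (v : E) :
    fderiv ℝ (fun y => G y (tangentialProj y u) (tangentialProj y a) (tangentialProj y c)) x v =
      fderiv ℝ G x v u a c - ((‖x‖ ^ 2)⁻¹ * ⟪tangentialProj x v, u⟫) • G x x a c -
        ((‖x‖ ^ 2)⁻¹ * ⟪tangentialProj x v, a⟫) • G x u x c -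
        ((‖x‖ ^ 2)⁻¹ * ⟪tangentialProj x v, c⟫) • G x u a x := by
  rw [fderiv_trilinear_tangentialProj_apply hG hx, tangentialProj_eq_self hu,
    tangentialProj_eq_self ha, tangentialProj_eq_self hc, hu, ha, hc]
  simp only [zero_smul, zero_add, smul_smul, map_smul, neg_mul, neg_smul,
    FunLike.coe_smul, Pi.smul_apply, map_neg, FunLike.coe_neg, Pi.neg_apply]
  abel

end Literature.Analysis.Calculus
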